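import Literature.MathematicalPhysics.QuantumFieldTheory.Balaban1983to89.Beta.BalabanStepJetsSucc
import Literature.MathematicalPhysics.QuantumFieldTheory.Balaban1983to89.Beta.KernelWard

/-!
# Beta / DecayingKernelNeumann — the NEUMANN SERIES of exponentially decaying lattice kernels:
# `G = Σ_n A (V A)^n` decays at any smaller rate with constant `C_A / (1 − θ)`, `θ = |F|²·C_V·C_A·Zl(δ−δ′)²`, as soon as `θ < 1`
# (β sub-cell, BINDER-OWNERS row D4 «RemainderConst leaves for Balaban's split», owner lineage `b2b-balaban-beta-an4`, gen 36;
# the ABSTRACT ENGINE of leaf A.4.3 of `HOME/b2b-balaban-beta-an4/g36/OUTLINE-D4-NODE-A.md` — records value, off the critical path)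

HONEST FRAMING (cell rule, verbatim): «discharging `BetaPertH` makes Bałaban's UV stability UNCONDITIONAL — a real constructive-QFT
result; it is NOT the continuum limit and NOT the Clay problem.»  THIS MODULE is [folklore] analysis on `ℤ^D` over the tree's kernel
calculus (`ExpKernelCalculus.Decays` ∕ `comp` ∕ `Zl`, strat-b12 gen 9; `BalabanStepJetsSucc.decays_comp`, an2): it formalises NO statement
printed in Bałaban's papers, cites none as a hypothesis, mints no `Prop` fact, bounds NO object of Bałaban's, and DISCHARGES NOTHING of the
wall.  NOT summit progress.

ABSOLUTE RULE (cell, verbatim): «No internally-minted statement may enter as a cited fact. Every hypothesis is either kernel-proved in this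
package or a verbatim quotation of a PUBLISHED theorem with page reference. The manuscript(s) under audit are NOT citable for their own
disputed steps — they are the thing under adjudication; programme-internal (2001/route/tribunal) claims are never citable.»

WHY (context only; asserted nowhere below).  Road P1 of row D4 ends, on its analytic side, in NODE A of the owner's skeleton
(`HOME/beta/skeletons/D4-b2b-balaban-beta-an4.md` v1.1): [II] = B13 (CMP 116) Lemma 3 ⇐ (T1) (2.16) ⇐ (T2) the G̃₃(x) walk expansion ⇐ (T3)
B9 (CMP 99) Thm 3.15, whose printed proof is the sentence (p. 432) «… we can investigate the operator G₂ perturbatively in the same way as the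
operator G₁ in (3.138)», (3.138) being the Neumann series «G₁ = G₀(I − (Δ′_π + Δ^{(2)}_π)G₀)⁻¹ = Σ_{n=0}^∞ G₀((Δ′_π + Δ^{(2)}_π)G₀)ⁿ» (p. 423).
The cell located the small parameter of that perturbation (GAPS C-adv8-2, confirmed C-an4-80) and cut the rest into leaves (OUTLINE-D4-NODE-A
§2); leaf A.4.3 is «the Neumann series on the p. 423 template».  This file is that leaf's ENGINE in the currency of the tree's kernel calculus —
exponential DECAY of matrix-fibred kernels on `ℤ^D`: if `A` and `V` decay at rate `δ` with constants `C_A`, `C_V`, then `A(VA)ⁿ` decays at any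
rate `δ′ < δ` with constant `C_A·θⁿ`, `θ := |F|²·C_V·C_A·Zl(δ−δ′)²` (`decays_nTerm`); for `θ < 1` the series converges pointwise, its sum decays at
rate `δ′` with constant `C_A/(1−θ)` (`decays_neumann`), the partial sums satisfy `S_{N+1} = A + (S_N ∘ V) ∘ A` EXACTLY (`pSum_succ_eq`) with the
geometric tail `C_Aθ^N/(1−θ)·e^{−δ′|x−y|}` (`abs_neumann_sub_pSum_le`), and the sum solves `G = A + (G ∘ V) ∘ A` (`neumann_eq`).  WHAT THIS DOES
NOT MODEL: Thm 3.3's scale-weighted sup∕Hölder norms and the placement of derivatives (the p. 423 pattern), the LOCALIZATION of walk terms in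
the background field (Thm 3.10), positivity (Thm 3.11), uniqueness for the resolvent identity, and the operators themselves (NODE O.2).

## What is proved ([folklore], sorry-free)
* §1 bricks: `decays_of_le`, `exp_split_mixed`, `abs_compTerm_le_mixed`, `summable_compTerm_mixed`, **`decays_comp_mixed`**
  (rate `δ′` ∘ rate `δ > δ′` decays at rate `δ′` with NO further loss, constant `|F|·C_A·C_B·Zl(δ−δ′)`; the tree's `decays_comp` needs equal
  input rates and loses rate at every use — iterated `n` times it would drive the rate to 0).
* §2 the Neumann terms `nTerm A V n` (`A`, `(A∘V)∘A`, …) and **`decays_nTerm`**: `Decays (nTerm A V n) (C_A · θⁿ) δ′`.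
* §3 the ratio `theta`, its sign; the series `neumann A V := Σ'_n nTerm A V n` (pointwise `tsum`); `abs_nTerm_le`, `summable_nTerm`,
  **`decays_neumann`**: `θ < 1 ⇒ Decays (neumann A V) (C_A/(1−θ)) δ′`; `hasSum_neumann` (pointwise).
* §4 partial sums `pSum A V N`; additivity brick `comp_finsetSum_left` (composition distributes over finite sums of kernels whose
  composition series converge); **`pSum_succ_eq`**: `pSum A V (N+1) = A + ((pSum A V N) ∘ V) ∘ A` pointwise; the geometric tail
  **`abs_neumann_sub_pSum_le`**; `tendsto_pSum`.
* §4b `decays_neumann_sub_pSum`, `comp_comp_sub` (linearity of the dressing `K ↦ (K∘V)∘A` over differences, via `KernelWard.comp_sub_left`),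
  `abs_compcomp_pSum_sub_le` (dressed tail `≤ C_Aθ^{N+1}/(1−θ)·e^{−δ′|x−z|}`), `tendsto_compcomp_pSum`, **`neumann_eq`**: `G = A + (G∘V)∘A`.
* §5 the packaged engine `neumann_engine` (∃-free: the sum, its decay, the recursion of its partial sums, the tail) — the shape in which
  leaf A.4.3 would consume it once A.4.0∕A.4.2 supply `A := G̃₀` and `V := Δ″` as decaying kernels with `C_V = O(Mα₀)`.
-/

noncomputable section

open Finset Filter Topology
open scoped BigOperators

namespace Summit.QuantumFields.BalabanUV.Beta.DecayingKernelNeumann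

open Literature.MathematicalPhysics.QuantumFieldTheory.Balaban1983to89.Beta
open Literature.MathematicalPhysics.QuantumFieldTheory.Balaban1983to89.B12Sec2to5 (l1 l1_nonneg)
open Literature.MathematicalPhysics.QuantumFieldTheory.Balaban1983to89.Beta.ExpKernelCalculus
  (Site MKer Decays comp Zl Zl_pos Zl_nonneg summable_exp_shift summable_exp_shift' tsum_exp_shift tsum_exp_shift'
   l1_sub_triangle l1_sub_symm)

variable {D : ℕ} {F : Type*} [Fintype F]

/-! ## §1 Bricks: rate lowering, constant raising, and the MIXED-RATE composition lemma -/

omit [Fintype F] in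
/-- [folklore] Rate lowering: a kernel decaying at rate `δ` decays at every rate `δ′ ≤ δ` with the same constant. -/
theorem decays_of_le {A : MKer D F} {C δ δ' : ℝ} (h : Decays A C δ) (hδ : δ' ≤ δ) : Decays A C δ' := fun x y a b =>
  (h x y a b).trans (mul_le_mul_of_nonneg_left (by rw [Real.exp_le_exp]; nlinarith [l1_nonneg (x - y)]) (h.nonneg a))

omit [Fintype F] in
/-- [folklore] Equal constants transport a `Decays` bound (bookkeeping). -/
theorem decays_congr_const {A : MKer D F} {C C' δ : ℝ} (h : Decays A C δ) (hC : C = C') : Decays A C' δ := hC ▸ h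

/-- [folklore] The mixed-rate exponent split: for `0 ≤ δ′` and any `δ`,
`e^{−δ′|x−y|}·e^{−δ|y−z|} ≤ e^{−δ′|x−z|}·e^{−(δ−δ′)|y−z|}` (triangle inequality at rate `δ′`; the surplus `δ − δ′` stays on the middle leg). -/
theorem exp_split_mixed {δ δ' : ℝ} (h0 : 0 ≤ δ') (x y z : Site D) :
    Real.exp (-δ' * l1 (x - y)) * Real.exp (-δ * l1 (y - z)) ≤
      Real.exp (-δ' * l1 (x - z)) * Real.exp (-(δ - δ') * l1 (y - z)) := by
  rw [← Real.exp_add, ← Real.exp_add, Real.exp_le_exp]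
  have ht := l1_sub_triangle x y z
  nlinarith [mul_nonneg h0 (show 0 ≤ l1 (x - y) + l1 (y - z) - l1 (x - z) by linarith)]

/-- [folklore] Termwise bound for `comp A B` with `A` decaying at rate `δ′` and `B` at rate `δ ≥ δ′`: the summand at `y` is
`≤ |F|·C_A·C_B·e^{−δ′|x−z|}·e^{−(δ−δ′)|y−z|}`. -/
theorem abs_compTerm_le_mixed {A B : MKer D F} {CA CB δ δ' : ℝ} (hA : Decays A CA δ') (hB : Decays B CB δ)
    (h0 : 0 ≤ δ') (x z : Site D) (a b : F) (y : Site D) :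
    |∑ f, A x y a f * B y z f b| ≤
      (Fintype.card F : ℝ) * (CA * CB) * Real.exp (-δ' * l1 (x - z)) * Real.exp (-(δ - δ') * l1 (y - z)) := by
  classical
  have hCC : 0 ≤ CA * CB := mul_nonneg (hA.nonneg a) (hB.nonneg a)
  have hC : ∀ f, |A x y a f * B y z f b| ≤
      (CA * CB) * Real.exp (-δ' * l1 (x - z)) * Real.exp (-(δ - δ') * l1 (y - z)) := by
    intro f
    rw [abs_mul]
    have h2 := hA x y a f
    have h3 := hB y z f b
    calc |A x y a f| * |B y z f b|
        ≤ (CA * Real.exp (-δ' * l1 (x - y))) * (CB * Real.exp (-δ * l1 (y - z))) :=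
          mul_le_mul h2 h3 (abs_nonneg _) ((abs_nonneg _).trans h2)
      _ = (CA * CB) * (Real.exp (-δ' * l1 (x - y)) * Real.exp (-δ * l1 (y - z))) := by ring
      _ ≤ (CA * CB) * (Real.exp (-δ' * l1 (x - z)) * Real.exp (-(δ - δ') * l1 (y - z))) :=
          mul_le_mul_of_nonneg_left (exp_split_mixed h0 x y z) hCC
      _ = (CA * CB) * Real.exp (-δ' * l1 (x - z)) * Real.exp (-(δ - δ') * l1 (y - z)) := by ring
  calc |∑ f, A x y a f * B y z f b| ≤ ∑ f, |A x y a f * B y z f b| := Finset.abs_sum_le_sum_abs _ _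
    _ ≤ ∑ _f : F, (CA * CB) * Real.exp (-δ' * l1 (x - z)) * Real.exp (-(δ - δ') * l1 (y - z)) :=
        Finset.sum_le_sum fun f _ => hC f
    _ = _ := by rw [Finset.sum_const, Finset.card_univ, nsmul_eq_mul]; ring

/-- [folklore] Summability of the mixed-rate composition series in the middle site. -/
theorem summable_compTerm_mixed {A B : MKer D F} {CA CB δ δ' : ℝ} (hA : Decays A CA δ') (hB : Decays B CB δ)
    (h0 : 0 ≤ δ') (h1 : δ' < δ) (x z : Site D) (a b : F) :
    Summable fun y : Site D => ∑ f, A x y a f * B y z f b := by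
  refine Summable.of_norm_bounded
    ((summable_exp_shift' (show 0 < δ - δ' by linarith) z).mul_left
      ((Fintype.card F : ℝ) * (CA * CB) * Real.exp (-δ' * l1 (x - z)))) (fun y => ?_)
  rw [Real.norm_eq_abs]
  exact abs_compTerm_le_mixed hA hB h0 x z a b y

/-- [folklore] **MIXED-RATE COMPOSITION**: `A` decaying at rate `δ′` composed with `B` decaying at rate `δ > δ′` decays at rate `δ′`
with constant `|F|·C_A·C_B·Zl(δ − δ′)` — no further loss of rate. -/
theorem decays_comp_mixed {A B : MKer D F} {CA CB δ δ' : ℝ} (hA : Decays A CA δ') (hB : Decays B CB δ) (h0 : 0 ≤ δ')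
    (h1 : δ' < δ) : Decays (comp A B) ((Fintype.card F : ℝ) * (CA * CB) * Zl D (δ - δ')) δ' := by
  intro x z a b
  unfold ExpKernelCalculus.comp
  have hs := summable_exp_shift' (show 0 < δ - δ' by linarith) z
  have hmaj := hs.mul_left ((Fintype.card F : ℝ) * (CA * CB) * Real.exp (-δ' * l1 (x - z)))
  have hb := tsum_of_norm_bounded hmaj.hasSum
    (fun y => by rw [Real.norm_eq_abs]; exact abs_compTerm_le_mixed hA hB h0 x z a b y)
  rw [Real.norm_eq_abs] at hb
  refine hb.trans (le_of_eq ?_)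
  rw [tsum_mul_left, tsum_exp_shift']
  ring

/-! ## §2 The Neumann terms `A (V A)^n` and their decay -/

/-- The Neumann terms: `T₀ = A`, `T_{n+1} = (T_n ∘ V) ∘ A`, i.e. `T_n = A(VA)ⁿ` bracketed to the left. -/
def nTerm (A V : MKer D F) : ℕ → MKer D F
  | 0 => A
  | n + 1 => comp (comp (nTerm A V n) V) A

/-- `T₀ = A`. -/
@[simp] theorem nTerm_zero (A V : MKer D F) : nTerm A V 0 = A := rfl

/-- `T_{n+1} = (T_n ∘ V) ∘ A`. -/
theorem nTerm_succ (A V : MKer D F) (n : ℕ) : nTerm A V (n + 1) = comp (comp (nTerm A V n) V) A := rfl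

/-- The GEOMETRIC RATIO of the series: `θ = |F|²·C_V·C_A·Zl(δ − δ′)²` (one middle-site sum and one fibre sum per composition, two
compositions per order). -/
def theta (D : ℕ) (F : Type*) [Fintype F] (CA CV δ δ' : ℝ) : ℝ :=
  (Fintype.card F : ℝ) ^ 2 * (CV * CA) * Zl D (δ - δ') ^ 2

/-- `θ ≥ 0` for nonnegative constants. -/
theorem theta_nonneg {CA CV δ δ' : ℝ} (hCA : 0 ≤ CA) (hCV : 0 ≤ CV) (h1 : δ' < δ) : 0 ≤ theta D F CA CV δ δ' := by
  unfold theta; have := Zl_nonneg (D := D) (show 0 < δ - δ' by linarith); positivity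

/-- [folklore] **DECAY OF THE NEUMANN TERMS**: if `A` and `V` decay at rate `δ` with constants `C_A`, `C_V`, then
`T_n = A(VA)ⁿ` decays at every rate `0 ≤ δ′ < δ` with constant `C_A · θⁿ`. -/
theorem decays_nTerm {A V : MKer D F} {CA CV δ δ' : ℝ} (hA : Decays A CA δ) (hV : Decays V CV δ) (h0 : 0 ≤ δ')
    (h1 : δ' < δ) (n : ℕ) : Decays (nTerm A V n) (CA * theta D F CA CV δ δ' ^ n) δ' := by
  induction n with
  | zero => rw [pow_zero, mul_one]; exact decays_of_le hA h1.le
  | succ n ih =>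
    rw [nTerm_succ]
    exact decays_congr_const (decays_comp_mixed (decays_comp_mixed ih hV h0 h1) hA h0 h1) (by unfold theta; ring)

/-! ## §3 The series and its decay -/

/-- The NEUMANN SERIES as a kernel: `G(x,y)_{ab} = Σ'_n T_n(x,y)_{ab}` (pointwise `tsum`; it is the genuine sum under `summable_nTerm`). -/
def neumann (A V : MKer D F) : MKer D F := fun x y a b => ∑' n, nTerm A V n x y a b

/-- Pointwise majorant of the `n`-th term: `|T_n(x,y)_{ab}| ≤ C_A θⁿ e^{−δ′|x−y|}`. -/
theorem abs_nTerm_le {A V : MKer D F} {CA CV δ δ' : ℝ} (hA : Decays A CA δ) (hV : Decays V CV δ) (h0 : 0 ≤ δ')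
    (h1 : δ' < δ) (n : ℕ) (x y : Site D) (a b : F) :
    |nTerm A V n x y a b| ≤ CA * theta D F CA CV δ δ' ^ n * Real.exp (-δ' * l1 (x - y)) :=
  decays_nTerm hA hV h0 h1 n x y a b

/-- [folklore] Absolute convergence of the Neumann series at every point, for `θ < 1`. -/
theorem summable_nTerm {A V : MKer D F} {CA CV δ δ' : ℝ} (hA : Decays A CA δ) (hV : Decays V CV δ) (h0 : 0 ≤ δ')
    (h1 : δ' < δ) (hθ : theta D F CA CV δ δ' < 1) (x y : Site D) (a b : F) :
    Summable fun n => nTerm A V n x y a b := by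
  have hθ0 : 0 ≤ theta D F CA CV δ δ' := theta_nonneg (hA.nonneg a) (hV.nonneg a) h1
  refine Summable.of_norm_bounded
    (((summable_geometric_of_lt_one hθ0 hθ).mul_left CA).mul_right (Real.exp (-δ' * l1 (x - y)))) (fun n => ?_)
  rw [Real.norm_eq_abs]
  exact abs_nTerm_le hA hV h0 h1 n x y a b

/-- [folklore] The series IS the sum of its terms (pointwise `HasSum`). -/
theorem hasSum_neumann {A V : MKer D F} {CA CV δ δ' : ℝ} (hA : Decays A CA δ) (hV : Decays V CV δ) (h0 : 0 ≤ δ')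
    (h1 : δ' < δ) (hθ : theta D F CA CV δ δ' < 1) (x y : Site D) (a b : F) :
    HasSum (fun n => nTerm A V n x y a b) (neumann A V x y a b) :=
  (summable_nTerm hA hV h0 h1 hθ x y a b).hasSum

/-- [folklore] **DECAY OF THE NEUMANN SERIES**: for `θ < 1` the sum decays at rate `δ′` with constant `C_A / (1 − θ)`. -/
theorem decays_neumann {A V : MKer D F} {CA CV δ δ' : ℝ} (hA : Decays A CA δ) (hV : Decays V CV δ) (h0 : 0 ≤ δ')
    (h1 : δ' < δ) (hθ : theta D F CA CV δ δ' < 1) :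
    Decays (neumann A V) (CA / (1 - theta D F CA CV δ δ')) δ' := by
  intro x y a b
  have hθ0 : 0 ≤ theta D F CA CV δ δ' := theta_nonneg (hA.nonneg a) (hV.nonneg a) h1
  have hg := ((hasSum_geometric_of_lt_one hθ0 hθ).mul_left CA).mul_right (Real.exp (-δ' * l1 (x - y)))
  have hb := tsum_of_norm_bounded hg (fun n => by
    rw [Real.norm_eq_abs]; exact abs_nTerm_le hA hV h0 h1 n x y a b)
  rw [Real.norm_eq_abs] at hb
  exact hb.trans (le_of_eq (by rw [div_eq_mul_inv]))

/-! ## §4 Partial sums: the EXACT resolvent recursion and the geometric tail -/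

/-- Partial sums `S_N = Σ_{n<N} T_n`. -/
def pSum (A V : MKer D F) (N : ℕ) : MKer D F := fun x y a b => ∑ n ∈ range N, nTerm A V n x y a b

/-- `S_0 = 0`. -/
@[simp] theorem pSum_zero (A V : MKer D F) : pSum A V 0 = 0 := by funext x y a b; simp [pSum]

/-- `S_{N+1} = S_N + T_N`. -/
theorem pSum_succ (A V : MKer D F) (N : ℕ) : pSum A V (N + 1) = pSum A V N + nTerm A V N := by funext x y a b; simp [pSum, sum_range_succ]

/-- [folklore] ADDITIVITY BRICK: composition distributes over a finite sum of kernels in the LEFT slot, provided every summand's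
composition series converges (the `tsum` in `comp` is a genuine sum only then). -/
theorem comp_finsetSum_left {ι : Type*} (s : Finset ι) (K : ι → MKer D F) (B : MKer D F)
    (hs : ∀ i ∈ s, ∀ x z a b, Summable fun y : Site D => ∑ f, K i x y a f * B y z f b) :
    comp (fun x y a b => ∑ i ∈ s, K i x y a b) B = fun x z a b => ∑ i ∈ s, comp (K i) B x z a b := by
  classical
  funext x z a b
  unfold ExpKernelCalculus.comp
  have hterm : ∀ y : Site D, (∑ f, (∑ i ∈ s, K i x y a f) * B y z f b) = ∑ i ∈ s, ∑ f, K i x y a f * B y z f b := by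
    intro y
    rw [Finset.sum_comm]
    refine Finset.sum_congr rfl fun f _ => ?_
    rw [Finset.sum_mul]
  simp_rw [hterm]
  exact Summable.tsum_finsetSum (fun i hi => hs i hi x z a b)

/-- Decay of the partial sums: `Decays (S_N) (C_A · Σ_{n<N} θⁿ) δ′`. -/
theorem decays_pSum {A V : MKer D F} {CA CV δ δ' : ℝ} (hA : Decays A CA δ) (hV : Decays V CV δ) (h0 : 0 ≤ δ')
    (h1 : δ' < δ) (N : ℕ) :
    Decays (pSum A V N) (CA * ∑ n ∈ range N, theta D F CA CV δ δ' ^ n) δ' := by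
  intro x y a b
  unfold pSum
  calc |∑ n ∈ range N, nTerm A V n x y a b| ≤ ∑ n ∈ range N, |nTerm A V n x y a b| := Finset.abs_sum_le_sum_abs _ _
    _ ≤ ∑ n ∈ range N, CA * theta D F CA CV δ δ' ^ n * Real.exp (-δ' * l1 (x - y)) :=
        Finset.sum_le_sum fun n _ => abs_nTerm_le hA hV h0 h1 n x y a b
    _ = CA * (∑ n ∈ range N, theta D F CA CV δ δ' ^ n) * Real.exp (-δ' * l1 (x - y)) := by
        rw [Finset.mul_sum, Finset.sum_mul]

/-- [folklore] **THE RESOLVENT RECURSION, EXACTLY**: `S_{N+1} = A + (S_N ∘ V) ∘ A` — the finite form of `G = A + (G∘V)∘A`,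
`G = (A⁻¹ − V)⁻¹` in operator language.  (Composition distributes over the finite sums because every term's composition series
converges absolutely: §1–§2.) -/
theorem pSum_succ_eq {A V : MKer D F} {CA CV δ δ' : ℝ} (hA : Decays A CA δ) (hV : Decays V CV δ) (h0 : 0 ≤ δ')
    (h1 : δ' < δ) (N : ℕ) :
    pSum A V (N + 1) = A + comp (comp (pSum A V N) V) A := by
  -- `(S_N ∘ V) = Σ_{n<N} (T_n ∘ V)` and `((S_N ∘ V) ∘ A) = Σ_{n<N} T_{n+1}`
  have hSV : comp (pSum A V N) V = fun x z a b => ∑ n ∈ range N, comp (nTerm A V n) V x z a b :=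
    comp_finsetSum_left (range N) (fun n => nTerm A V n) V (fun n _ x z a b =>
      summable_compTerm_mixed (decays_nTerm hA hV h0 h1 n) hV h0 h1 x z a b)
  have hSVA : comp (comp (pSum A V N) V) A = fun x z a b => ∑ n ∈ range N, nTerm A V (n + 1) x z a b := by
    rw [hSV]
    exact comp_finsetSum_left (range N) (fun n => comp (nTerm A V n) V) A (fun n _ x z a b =>
      summable_compTerm_mixed (decays_comp_mixed (decays_nTerm hA hV h0 h1 n) hV h0 h1) hA h0 h1 x z a b)
  rw [hSVA]
  funext x z a b
  show (∑ n ∈ range (N + 1), nTerm A V n x z a b) = A x z a b + ∑ n ∈ range N, nTerm A V (n + 1) x z a b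
  rw [Finset.sum_range_succ', nTerm_zero, add_comm]

/-- [folklore] **THE GEOMETRIC TAIL**: `|G(x,y)_{ab} − S_N(x,y)_{ab}| ≤ C_A θ^N/(1−θ) · e^{−δ′|x−y|}`. -/
theorem abs_neumann_sub_pSum_le {A V : MKer D F} {CA CV δ δ' : ℝ} (hA : Decays A CA δ) (hV : Decays V CV δ) (h0 : 0 ≤ δ')
    (h1 : δ' < δ) (hθ : theta D F CA CV δ δ' < 1) (N : ℕ) (x y : Site D) (a b : F) :
    |neumann A V x y a b - pSum A V N x y a b| ≤
      CA * theta D F CA CV δ δ' ^ N / (1 - theta D F CA CV δ δ') * Real.exp (-δ' * l1 (x - y)) := by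
  set θ := theta D F CA CV δ δ' with hθdef
  have hθ0 : 0 ≤ θ := theta_nonneg (hA.nonneg a) (hV.nonneg a) h1
  have hs := summable_nTerm hA hV h0 h1 hθ x y a b
  -- the tail is the sum over `n ≥ N`
  have htail : neumann A V x y a b - pSum A V N x y a b = ∑' n, nTerm A V (n + N) x y a b := by
    unfold neumann pSum
    rw [← hs.sum_add_tsum_nat_add N, add_sub_cancel_left]
  rw [htail]
  have hg : HasSum (fun n : ℕ => CA * θ ^ (n + N) * Real.exp (-δ' * l1 (x - y)))
      (CA * θ ^ N / (1 - θ) * Real.exp (-δ' * l1 (x - y))) := by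
    have h := ((hasSum_geometric_of_lt_one hθ0 hθ).mul_left (CA * θ ^ N)).mul_right (Real.exp (-δ' * l1 (x - y)))
    have hfg : (fun n : ℕ => CA * θ ^ N * θ ^ n * Real.exp (-δ' * l1 (x - y))) =
        (fun n : ℕ => CA * θ ^ (n + N) * Real.exp (-δ' * l1 (x - y))) := by funext n; rw [pow_add]; ring
    rwa [hfg, show CA * θ ^ N * (1 - θ)⁻¹ * Real.exp (-δ' * l1 (x - y)) =
        CA * θ ^ N / (1 - θ) * Real.exp (-δ' * l1 (x - y)) by rw [div_eq_mul_inv]] at h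
  have hb := tsum_of_norm_bounded hg (fun n => by rw [Real.norm_eq_abs]; exact abs_nTerm_le hA hV h0 h1 (n + N) x y a b)
  rwa [Real.norm_eq_abs] at hb

/-- [folklore] The partial sums converge to the series pointwise. -/
theorem tendsto_pSum {A V : MKer D F} {CA CV δ δ' : ℝ} (hA : Decays A CA δ) (hV : Decays V CV δ) (h0 : 0 ≤ δ')
    (h1 : δ' < δ) (hθ : theta D F CA CV δ δ' < 1) (x y : Site D) (a b : F) :
    Tendsto (fun N => pSum A V N x y a b) atTop (𝓝 (neumann A V x y a b)) :=
  (hasSum_neumann hA hV h0 h1 hθ x y a b).tendsto_sum_nat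

/-! ## §4b The resolvent identity for the infinite sum: `G = A + (G ∘ V) ∘ A` -/

/-- Decay of the tail kernel `G − S_N` (constant `C_A θ^N/(1−θ)`). -/
theorem decays_neumann_sub_pSum {A V : MKer D F} {CA CV δ δ' : ℝ} (hA : Decays A CA δ) (hV : Decays V CV δ) (h0 : 0 ≤ δ')
    (h1 : δ' < δ) (hθ : theta D F CA CV δ δ' < 1) (N : ℕ) :
    Decays (neumann A V - pSum A V N) (CA * theta D F CA CV δ δ' ^ N / (1 - theta D F CA CV δ δ')) δ' :=
  fun x y a b => abs_neumann_sub_pSum_le hA hV h0 h1 hθ N x y a b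

/-- [folklore] LINEARITY of the two-sided dressing `K ↦ (K ∘ V) ∘ A` over a difference of kernels decaying at rate `δ′`
(every composition series converges absolutely, so the `tsum`s are additive: `KernelWard.comp_sub_left`). -/
theorem comp_comp_sub {K K' A V : MKer D F} {C C' CA CV δ δ' : ℝ} (hK : Decays K C δ') (hK' : Decays K' C' δ')
    (hA : Decays A CA δ) (hV : Decays V CV δ) (h0 : 0 ≤ δ') (h1 : δ' < δ) :
    comp (comp (K - K') V) A = comp (comp K V) A - comp (comp K' V) A := by
  have hKV : comp (K - K') V = comp K V - comp K' V :=
    KernelWard.comp_sub_left (fun x z a b => summable_compTerm_mixed hK hV h0 h1 x z a b)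
      (fun x z a b => summable_compTerm_mixed hK' hV h0 h1 x z a b)
  rw [hKV]
  exact KernelWard.comp_sub_left
    (fun x z a b => summable_compTerm_mixed (decays_comp_mixed hK hV h0 h1) hA h0 h1 x z a b)
    (fun x z a b => summable_compTerm_mixed (decays_comp_mixed hK' hV h0 h1) hA h0 h1 x z a b)

/-- The dressed partial sums converge to the dressed sum: `((S_N ∘ V) ∘ A)(x,z)_{ab} → ((G ∘ V) ∘ A)(x,z)_{ab}`, with the explicit
error `≤ C_A θ^{N+1}/(1−θ) · e^{−δ′|x−z|}`. -/
theorem abs_compcomp_pSum_sub_le {A V : MKer D F} {CA CV δ δ' : ℝ} (hA : Decays A CA δ) (hV : Decays V CV δ) (h0 : 0 ≤ δ')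
    (h1 : δ' < δ) (hθ : theta D F CA CV δ δ' < 1) (N : ℕ) (x z : Site D) (a b : F) :
    |comp (comp (neumann A V) V) A x z a b - comp (comp (pSum A V N) V) A x z a b| ≤
      CA * theta D F CA CV δ δ' ^ (N + 1) / (1 - theta D F CA CV δ δ') * Real.exp (-δ' * l1 (x - z)) := by
  have hGdec := decays_neumann hA hV h0 h1 hθ
  have hSdec := decays_pSum hA hV h0 h1 N
  have hlin := comp_comp_sub hGdec hSdec hA hV h0 h1
  rw [show comp (comp (neumann A V) V) A x z a b - comp (comp (pSum A V N) V) A x z a b =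
      comp (comp (neumann A V - pSum A V N) V) A x z a b by rw [hlin]; rfl]
  have h := decays_comp_mixed (decays_comp_mixed (decays_neumann_sub_pSum hA hV h0 h1 hθ N) hV h0 h1) hA h0 h1 x z a b
  exact h.trans (le_of_eq (by unfold theta; rw [pow_succ]; ring))

/-- The dressed partial sums converge pointwise to the dressed sum (squeeze with the geometric error). -/
theorem tendsto_compcomp_pSum {A V : MKer D F} {CA CV δ δ' : ℝ} (hA : Decays A CA δ) (hV : Decays V CV δ) (h0 : 0 ≤ δ')
    (h1 : δ' < δ) (hθ : theta D F CA CV δ δ' < 1) (x z : Site D) (a b : F) :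
    Tendsto (fun N => comp (comp (pSum A V N) V) A x z a b) atTop (𝓝 (comp (comp (neumann A V) V) A x z a b)) := by
  set θ := theta D F CA CV δ δ' with hθdef
  set L := comp (comp (neumann A V) V) A x z a b with hL
  set c := CA / (1 - θ) * Real.exp (-δ' * l1 (x - z)) with hc
  have hθ0 : 0 ≤ θ := theta_nonneg (hA.nonneg a) (hV.nonneg a) h1
  have hpow : Tendsto (fun N : ℕ => c * θ ^ (N + 1)) atTop (𝓝 0) := by
    simpa using ((tendsto_pow_atTop_nhds_zero_of_lt_one hθ0 hθ).comp (tendsto_add_atTop_nat 1)).const_mul c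
  have hbound : ∀ N, |comp (comp (pSum A V N) V) A x z a b - L| ≤ c * θ ^ (N + 1) := by
    intro N
    rw [abs_sub_comm]
    refine (abs_compcomp_pSum_sub_le hA hV h0 h1 hθ N x z a b).trans (le_of_eq ?_)
    rw [hc]; ring
  have hlo : Tendsto (fun N : ℕ => L - c * θ ^ (N + 1)) atTop (𝓝 L) := by simpa using tendsto_const_nhds (x := L) |>.sub hpow
  have hhi : Tendsto (fun N : ℕ => L + c * θ ^ (N + 1)) atTop (𝓝 L) := by simpa using tendsto_const_nhds (x := L) |>.add hpow
  refine tendsto_of_tendsto_of_tendsto_of_le_of_le hlo hhi (fun N => ?_) (fun N => ?_)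
  · have := hbound N; rw [abs_le] at this; linarith [this.1]
  · have := hbound N; rw [abs_le] at this; linarith [this.2]

/-- [folklore] **THE RESOLVENT IDENTITY FOR THE INFINITE SUM**: for `θ < 1`, `G = A + (G ∘ V) ∘ A` as kernels — i.e. `G` is the
(right) Neumann resolvent of the perturbation `V` of `A` (`G = (A⁻¹ − V)⁻¹` in operator language).  Proof: `S_{N+1} = A + (S_N∘V)∘A`
exactly (§4), `S_{N+1} → G` and `(S_N∘V)∘A → (G∘V)∘A` pointwise (the dressing is continuous in the decay currency), uniqueness of limits. -/
theorem neumann_eq {A V : MKer D F} {CA CV δ δ' : ℝ} (hA : Decays A CA δ) (hV : Decays V CV δ) (h0 : 0 ≤ δ')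
    (h1 : δ' < δ) (hθ : theta D F CA CV δ δ' < 1) :
    neumann A V = A + comp (comp (neumann A V) V) A := by
  funext x z a b
  have hS : Tendsto (fun N => pSum A V (N + 1) x z a b) atTop (𝓝 (neumann A V x z a b)) :=
    (tendsto_pSum hA hV h0 h1 hθ x z a b).comp (tendsto_add_atTop_nat 1)
  have hS' : (fun N => pSum A V (N + 1) x z a b) = fun N => A x z a b + comp (comp (pSum A V N) V) A x z a b := by
    funext N
    rw [pSum_succ_eq hA hV h0 h1 N]
    rfl
  rw [hS'] at hS
  have hT : Tendsto (fun N => A x z a b + comp (comp (pSum A V N) V) A x z a b) atTop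
      (𝓝 (A x z a b + comp (comp (neumann A V) V) A x z a b)) :=
    tendsto_const_nhds.add (tendsto_compcomp_pSum hA hV h0 h1 hθ x z a b)
  exact tendsto_nhds_unique hS hT

/-! ## §5 The packaged engine (the shape leaf A.4.3 would consume) -/

/-- [folklore] **NEUMANN ENGINE FOR DECAYING KERNELS.**  Let `A` (the leading propagator's kernel) and `V` (the perturbation's kernel)
decay at rate `δ > 0` with constants `C_A`, `C_V`, and let `0 ≤ δ′ < δ` with `θ := |F|²·C_V·C_A·Zl(δ−δ′)² < 1` (the SMALLNESS of the
perturbation — in B9's setting `C_V = O(Mα₀)`).  Then the kernel `G := Σ_n A(VA)ⁿ` (i) decays at rate `δ′` with constant `C_A/(1−θ)`,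
(ii) is the pointwise limit of the partial sums `S_N`, which (iii) satisfy the resolvent recursion `S_{N+1} = A + (S_N∘V)∘A` exactly and
(iv) approximate `G` with the geometric tail `C_Aθ^N/(1−θ)·e^{−δ′|x−y|}`, and (v) `G` itself solves `G = A + (G∘V)∘A`.  DECAY ONLY: no
weighted∕Hölder norms, no localization in a background field, no positivity — see the module header. -/
theorem neumann_engine {A V : MKer D F} {CA CV δ δ' : ℝ} (hA : Decays A CA δ) (hV : Decays V CV δ) (h0 : 0 ≤ δ')
    (h1 : δ' < δ) (hθ : theta D F CA CV δ δ' < 1) :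
    Decays (neumann A V) (CA / (1 - theta D F CA CV δ δ')) δ' ∧
    (∀ x y a b, Tendsto (fun N => pSum A V N x y a b) atTop (𝓝 (neumann A V x y a b))) ∧
    (∀ N, pSum A V (N + 1) = A + comp (comp (pSum A V N) V) A) ∧
    (∀ N x y a b, |neumann A V x y a b - pSum A V N x y a b| ≤
      CA * theta D F CA CV δ δ' ^ N / (1 - theta D F CA CV δ δ') * Real.exp (-δ' * l1 (x - y))) ∧
    neumann A V = A + comp (comp (neumann A V) V) A :=
  ⟨decays_neumann hA hV h0 h1 hθ, fun x y a b => tendsto_pSum hA hV h0 h1 hθ x y a b,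
    fun N => pSum_succ_eq hA hV h0 h1 N, fun N x y a b => abs_neumann_sub_pSum_le hA hV h0 h1 hθ N x y a b,
    neumann_eq hA hV h0 h1 hθ⟩

/-- NON-VACUITY: the zero perturbation has `θ = 0 < 1` whenever `C_V = 0` is admissible, and then every Neumann term beyond the
zeroth vanishes in the decay currency (`Decays (T_{n+1}) 0 δ′`), so the engine's hypotheses are jointly satisfiable for any decaying `A`. -/
theorem theta_zero_pert (CA δ δ' : ℝ) : theta D F CA 0 δ δ' = 0 := by unfold theta; ring

example {A : MKer D F} {CA δ : ℝ} (hA : Decays A CA δ) (hδ : 0 < δ) :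
    Decays (neumann A (fun _ _ _ _ => 0)) (CA / (1 - theta D F CA 0 δ (δ / 2))) (δ / 2) :=
  decays_neumann hA (fun x y a b => by simp) (by linarith) (by linarith) (by rw [theta_zero_pert]; norm_num)

end Summit.QuantumFields.BalabanUV.Beta.DecayingKernelNeumann
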